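import Literature.AlgebraicGeometry.ComplexMultiplication.CyclotomicFermatCMTypesKoblitzEllipticFieldsImprimitive
import Literature.AlgebraicGeometry.ComplexMultiplication.CyclotomicFermatCMTypesKoblitzEllipticLevels
import HarnessLib

/-!
# Koblitz's elliptic Fermat factors, level by level (companion): at the levels `48, 60` EVERY primitive elliptic triple has THE SAME group `H`
# — CM fields `ℚ(√−6), ℚ(√−3)`

Layer `Literature/AlgebraicGeometry/ComplexMultiplication`; companion of `CyclotomicFermatCMTypesKoblitzEllipticTriples` (levels `15–40`; same sources —
Koblitz–Rohrlich 1978 §1 p. 1184, §2 Remark 2; Bauer–Coste–Itzykson–Ruelle 1997 §3.3–3.4 (Koblitz's list [kob]) — and the same reading: normalised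
representative `(r, s, −r−s)`, `r, s ≠ 0`, `⟨r⟩ + ⟨s⟩ < N`, primitive iff `gcd(r, s, N) = 1`, «elliptic» ⟺ `H` closed under multiplication; this file
imports only the field files, not the companion).  THIS FILE: the two largest levels of Koblitz's list, one exhaustive kernel computation per level
(`decide +kernel`, ≈ `50 s` and `90 s`).  The kernel lists (unordered primitive normalised triples with `H` a group):
`48`: (1,22,25), (2,11,35), (5,14,29), (7,10,31) ↦ `{1, 5, 7, 11, 25, 29, 31, 35}` ↦ ℚ(√−6); `60`: (1,10,49), (7,10,43), (10,13,37), (10,19,31) ↦ `{1, 7, 13, 19, 31, 37, 43, 49}` ↦ ℚ(√−3).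
THEOREMS ONLY (no definition, no named fact, no `sorry`).  [kob] = Koblitz 1978 is NOT held (acq-13294); nothing is quoted from it.

## What is proved

* §1 **`CyclotomicFermatCMType.fermatCMType_eq_of_forall_mul_mem_N`**, `N ∈ {48, 60}`: primitive + normalised + `H` closed ⟹ `H =` the witness group.
* §2 **`CyclotomicFermatCMType.exists_isIsogeny_pow_elliptic_of_primitive_N`**: on abelian varieties — «isogenous to a power of an elliptic curve» ⟹
  `H =` the witness group ∧ `K₁ = ℚ(δ)`, `δ² = −6, −3` ∧ `A ∼ E⁸, E⁸` equivariantly, `E` elliptic with CM by `𝓞_{K₁}`.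

## Honest column

As in the companion (`…KoblitzEllipticTriples`).  With it and the siblings, for EVERY level `n₀` of the printed list the set of primitive elliptic triples and their CM fields are kernel theorems (ONE
field per level except at `8`, `12`, `24`, where `2, 2, 3` index-`2` groups occur among the primitive elliptic triples); the statement «no other `n₀`» remains Koblitz's theorem (CITE [kob]) beyond the census `n₀ ≤ 40`.  The Hodge
conjecture is not proved and nothing here bears on it.
-/


noncomputable section

open NumberField

namespace Literature.AlgebraicGeometry.ComplexMultiplication

open CategoryTheory CategoryTheory.Limits
open Literature.AlgebraicGeometry.Motives (CMType AbelianVariety)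
open Literature.AlgebraicGeometry.Motives.AbelianVariety
open Literature.NumberTheory.ComplexMultiplication
open Literature.AlgebraicGeometry.HodgeTheory
open Literature.AlgebraicGeometry.Pohlmann1968 Literature.AlgebraicGeometry.Pohlmann1968.Cyclotomic
open CyclotomicCMTypeResidueSets (IsCMResidueSet unitResidues residueSet residueSet_cmTypeOfResidues isCMResidueSet_residueSet
  autResidue autResidue_spec exists_autResidue_eq)

/-! ## §1 The classification of the primitive elliptic triples, levels `48, 60` (kernel) -/

namespace CyclotomicFermatCMType

set_option maxHeartbeats 1000000 in
/-- **Level `48`: EVERY primitive normalised triple `(r, s, −r−s)` modulo `48` whose `H_{r,s,t}` is closed under multiplication has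
`H_{r,s,t} = {1, 5, 7, 11, 25, 29, 31, 35}`** (kernel, exhaustive over `(ℤ/48)²`; up to the order of `r, s, t` these triples are `(1,22,25), (2,11,35), (5,14,29), (7,10,31)` — `24` ordered pairs `(r, s)`).
[cite: BauerCosteItzyksonRuelle1997, §3.4] [cite: KoblitzRohrlich1978, §1 p. 1184] -/
theorem fermatCMType_eq_of_forall_mul_mem_fortyEight : ∀ r s : ZMod 48, r ≠ 0 → s ≠ 0 → r.val + s.val < 48 → Nat.gcd (Nat.gcd r.val s.val) 48 = 1 →
    (∀ a ∈ fermatCMType 48 r s (-(r + s)), ∀ b ∈ fermatCMType 48 r s (-(r + s)), a * b ∈ fermatCMType 48 r s (-(r + s))) →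
    fermatCMType 48 r s (-(r + s)) = ({1, 5, 7, 11, 25, 29, 31, 35} : Finset (ZMod 48)) := by
  decide +kernel

set_option maxHeartbeats 1000000 in
/-- **Level `60`: EVERY primitive normalised triple `(r, s, −r−s)` modulo `60` whose `H_{r,s,t}` is closed under multiplication has
`H_{r,s,t} = {1, 7, 13, 19, 31, 37, 43, 49}`** (kernel, exhaustive over `(ℤ/60)²`; up to the order of `r, s, t` these triples are `(1,10,49), (7,10,43), (10,13,37), (10,19,31)` — `24` ordered pairs `(r, s)`).
[cite: BauerCosteItzyksonRuelle1997, §3.4] [cite: KoblitzRohrlich1978, §1 p. 1184] -/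
theorem fermatCMType_eq_of_forall_mul_mem_sixty : ∀ r s : ZMod 60, r ≠ 0 → s ≠ 0 → r.val + s.val < 60 → Nat.gcd (Nat.gcd r.val s.val) 60 = 1 →
    (∀ a ∈ fermatCMType 60 r s (-(r + s)), ∀ b ∈ fermatCMType 60 r s (-(r + s)), a * b ∈ fermatCMType 60 r s (-(r + s))) →
    fermatCMType 60 r s (-(r + s)) = ({1, 7, 13, 19, 31, 37, 43, 49} : Finset (ZMod 60)) := by
  decide +kernel

end CyclotomicFermatCMType

/-! ## §2 On abelian varieties -/

section Varieties

variable {L : Type} [Field L] [NumberField L]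

namespace CyclotomicFermatCMType

section L48

variable [IsCyclotomicExtension {48} ℚ L]

/-- **Level `48` ON ABELIAN VARIETIES: every primitive elliptic K–R factor type at level `48` has complex multiplication by `ℚ(√−6)`.**  For ANY
primitive normalised triple `(r, s, −r−s)` modulo `48` and any realisation `A` of `Φ_{H_{r,s,t}}`: if `A` is isogenous to a power of an elliptic curve, then
`H_{r,s,t} = {1, 5, 7, 11, 25, 29, 31, 35}`, the field of the primitive sub-pair is `K₁ = ℚ(δ)`, `δ² = −6`, and `A ∼ E^8` (`𝓞_{K₁}`-equivariantly) with `E` elliptic, CM by `𝓞_{K₁}`.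
[cite: KoblitzRohrlich1978, §1 p. 1184] [cite: BauerCosteItzyksonRuelle1997, §3.3–3.4] [cite: Shimura1998, §8.2 Prop. 26] -/
theorem exists_isIsogeny_pow_elliptic_of_primitive_fortyEight {r s : ZMod 48} (hr : r ≠ 0) (hs : s ≠ 0) (hrs : r.val + s.val < 48)
    (hprim : Nat.gcd (Nat.gcd r.val s.val) 48 = 1)
    {hS : ∀ c : ZMod 48, c.val.Coprime 48 → (c ∈ fermatCMType 48 r s (-(r + s)) ↔ -c ∉ fermatCMType 48 r s (-(r + s)))}
    {A : AbelianVariety ℂ} {ι : 𝓞 L →+* End A} {θ : L →+* Module.End ℂ (complexBetti A.X 1)}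
    (hA : IsCMTypeRealisation (cmTypeOfResidues (L := L) (fermatCMType 48 r s (-(r + s))) hS) A ι θ)
    (hE : ∃ (E P : AbelianVariety ℂ) (h : ℕ) (π : Fin h → (P ⟶ E)) (g : A ⟶ P), E.dim = 1 ∧ Nonempty (IsLimit (Fan.mk P π)) ∧ IsIsogeny g) :
    fermatCMType 48 r s (-(r + s)) = ({1, 5, 7, 11, 25, 29, 31, 35} : Finset (ZMod 48)) ∧
    ∃ (K₁ : IntermediateField ℚ L) (Φ₁ : CMType K₁), IsCMField K₁ ∧ Module.finrank ℚ K₁ = 2 ∧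
      zetaOf 48 L ^ 2 + zetaOf 48 L ^ 10 + zetaOf 48 L ^ 14 + zetaOf 48 L ^ 22 ∈ K₁ ∧
      K₁ = IntermediateField.adjoin ℚ {zetaOf 48 L ^ 2 + zetaOf 48 L ^ 10 + zetaOf 48 L ^ 14 + zetaOf 48 L ^ 22} ∧
      (zetaOf 48 L ^ 2 + zetaOf 48 L ^ 10 + zetaOf 48 L ^ 14 + zetaOf 48 L ^ 22) ^ 2 = -6 ∧
      inducedCMType (algebraMap K₁ L) Φ₁ = cmTypeOfResidues (L := L) (fermatCMType 48 r s (-(r + s))) hS ∧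
      ∃ (E : AbelianVariety ℂ) (ιE : 𝓞 K₁ →+* End E) (θE : K₁ →+* Module.End ℂ (complexBetti E.X 1)),
        IsCMTypeRealisation Φ₁ E ιE θE ∧ E.IsSimple ∧ E.dim = 1 ∧
        ∃ (h : ℕ) (P : AbelianVariety ℂ) (π : Fin h → (P ⟶ E)), Nonempty (IsLimit (Fan.mk P π)) ∧ h = 8 ∧
          ∃ g : A ⟶ P, IsIsogeny g ∧
            ∀ (j : Fin h) (b : 𝓞 K₁), ι (RingOfIntegers.mapRingHom (algebraMap K₁ L : K₁ →+* L) b) ≫ (g ≫ π j) = (g ≫ π j) ≫ ιE b := by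
  haveI : IsCMField L := IsCyclotomicExtension.Rat.isCMField L (S := {48}) ⟨48, rfl, by norm_num⟩
  have hcl := (exists_isIsogeny_pow_elliptic_fermat_iff_forall_mul_mem (by norm_num) (one_mem_fermatCMType_of_val_add_lt hr hrs) hA).1 hE
  have hH := fermatCMType_eq_of_forall_mul_mem_fortyEight r s hr hs hrs hprim hcl
  refine ⟨hH, exists_isIsogeny_pow_elliptic_fortyEight hA ?_⟩
  rw [residueSet_cmTypeOfResidues 48 (isCMResidueSet_fermatCMType hS), hH]
  exact stabilizerResidues_fortyEight

end L48

section L60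

variable [IsCyclotomicExtension {60} ℚ L]

/-- **Level `60` ON ABELIAN VARIETIES: every primitive elliptic K–R factor type at level `60` has complex multiplication by `ℚ(√−3)`.**  For ANY
primitive normalised triple `(r, s, −r−s)` modulo `60` and any realisation `A` of `Φ_{H_{r,s,t}}`: if `A` is isogenous to a power of an elliptic curve, then
`H_{r,s,t} = {1, 7, 13, 19, 31, 37, 43, 49}`, the field of the primitive sub-pair is `K₁ = ℚ(δ)`, `δ² = −3`, and `A ∼ E^8` (`𝓞_{K₁}`-equivariantly) with `E` elliptic, CM by `𝓞_{K₁}`.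
[cite: KoblitzRohrlich1978, §1 p. 1184] [cite: BauerCosteItzyksonRuelle1997, §3.3–3.4] [cite: Shimura1998, §8.2 Prop. 26] -/
theorem exists_isIsogeny_pow_elliptic_of_primitive_sixty {r s : ZMod 60} (hr : r ≠ 0) (hs : s ≠ 0) (hrs : r.val + s.val < 60)
    (hprim : Nat.gcd (Nat.gcd r.val s.val) 60 = 1)
    {hS : ∀ c : ZMod 60, c.val.Coprime 60 → (c ∈ fermatCMType 60 r s (-(r + s)) ↔ -c ∉ fermatCMType 60 r s (-(r + s)))}
    {A : AbelianVariety ℂ} {ι : 𝓞 L →+* End A} {θ : L →+* Module.End ℂ (complexBetti A.X 1)}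
    (hA : IsCMTypeRealisation (cmTypeOfResidues (L := L) (fermatCMType 60 r s (-(r + s))) hS) A ι θ)
    (hE : ∃ (E P : AbelianVariety ℂ) (h : ℕ) (π : Fin h → (P ⟶ E)) (g : A ⟶ P), E.dim = 1 ∧ Nonempty (IsLimit (Fan.mk P π)) ∧ IsIsogeny g) :
    fermatCMType 60 r s (-(r + s)) = ({1, 7, 13, 19, 31, 37, 43, 49} : Finset (ZMod 60)) ∧
    ∃ (K₁ : IntermediateField ℚ L) (Φ₁ : CMType K₁), IsCMField K₁ ∧ Module.finrank ℚ K₁ = 2 ∧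
      1 + 2 * zetaOf 60 L ^ 20 ∈ K₁ ∧
      K₁ = IntermediateField.adjoin ℚ {1 + 2 * zetaOf 60 L ^ 20} ∧
      (1 + 2 * zetaOf 60 L ^ 20) ^ 2 = -3 ∧
      inducedCMType (algebraMap K₁ L) Φ₁ = cmTypeOfResidues (L := L) (fermatCMType 60 r s (-(r + s))) hS ∧
      ∃ (E : AbelianVariety ℂ) (ιE : 𝓞 K₁ →+* End E) (θE : K₁ →+* Module.End ℂ (complexBetti E.X 1)),
        IsCMTypeRealisation Φ₁ E ιE θE ∧ E.IsSimple ∧ E.dim = 1 ∧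
        ∃ (h : ℕ) (P : AbelianVariety ℂ) (π : Fin h → (P ⟶ E)), Nonempty (IsLimit (Fan.mk P π)) ∧ h = 8 ∧
          ∃ g : A ⟶ P, IsIsogeny g ∧
            ∀ (j : Fin h) (b : 𝓞 K₁), ι (RingOfIntegers.mapRingHom (algebraMap K₁ L : K₁ →+* L) b) ≫ (g ≫ π j) = (g ≫ π j) ≫ ιE b := by
  haveI : IsCMField L := IsCyclotomicExtension.Rat.isCMField L (S := {60}) ⟨60, rfl, by norm_num⟩
  have hcl := (exists_isIsogeny_pow_elliptic_fermat_iff_forall_mul_mem (by norm_num) (one_mem_fermatCMType_of_val_add_lt hr hrs) hA).1 hE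
  have hH := fermatCMType_eq_of_forall_mul_mem_sixty r s hr hs hrs hprim hcl
  refine ⟨hH, exists_isIsogeny_pow_elliptic_sixty hA ?_⟩
  rw [residueSet_cmTypeOfResidues 60 (isCMResidueSet_fermatCMType hS), hH]
  exact stabilizerResidues_sixty

end L60

end CyclotomicFermatCMType

end Varieties

end Literature.AlgebraicGeometry.ComplexMultiplication
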